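import Mathlib
import HarnessLib
import Summits.Ventures.LatticeQCDFlow.Exactness.U1LeapfrogHMCErgodic
import Summits.Ventures.LatticeQCDFlow.Exactness.WilsonHeatBathErgodic

/-!
# Single-step leapfrog HMC converges to the torus Wilson measure of compact `U(1)` lattice gauge theory from every start

HONEST FRAMING: exact (Metropolis-corrected) sampling algorithms for lattice gauge theory;
figures of merit are autocorrelation/cost numbers at stated couplings and volumes; no
continuum-physics claim.

Venture `LatticeQCDFlow` (cell pub-lqcd), topic `Exactness`, FANOUT row 9 (eng-latcore, the
engine `latflow.core.u1_2d.U1Field2D.hmc_trajectory(β, τ = ε, nstep = 1)` and the `U(1)` rung of `latflow.fthmc`).  NEW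
WORK of the cell: the ENGINE INSTANCE of `U1LeapfrogHMCErgodic.lean` (Doeblin + uniform
ergodicity of the single-step leapfrog HMC kernel `u1LeapfrogHMC` for any bounded measurable
action) for the Literature's finite-volume Wilson lattice gauge theory
(`Literature.MathematicalPhysics.QuantumFieldTheory.wilsonMeasure`, file `ConstructiveQFTWave0.lean`:
`μ_{Λ,β} = Z⁻¹ e^{−β S_W} ∏ₑ dHaar(U_e)` on `GaugeConfig d L G = Edge d L → G`, torus `(ℤ/L)^d`) with
`G = U(1) = Circle` and any continuous matrix representation `ρ` (the engine: `u1Rep`, `e^{iθ} ↦ (e^{iθ})`; STEP-0's 2D `U(1)` rungs are `d = 2`).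
Continuity of `U ↦ β S_W(U)` is row 9's `WilsonHeatBathErgodic.continuous_smul_wilsonAction`.
Nothing is cited as a fact; the Literature definitions are used, not restated.

* `u1GibbsLaw_eq_wilsonMeasure` — the Gibbs law `Z_S⁻¹ e^{−S}·Haar^{⊗E}` of `S = β S_W` IS the
  Literature's `wilsonMeasure ρ β` (definitional up to `−(β S_W) = (−β) S_W`);
* `exists_bound_smul_wilsonAction_circle` — `|β S_W| ≤ s` on the (compact) configuration space;
* **`wilson_u1LeapfrogHMC_uniformlyErgodic`** — for every `d`, `L ≥ 1`, real `β`, step `ε > 0`,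
  kinetic coefficient `κ > 0` and every measurable momentum increment `g` bounded by `b ≥ 0` (the
  engine's half-kick `−½ε ∂(βS_W)`, bounded because the force of the Wilson action is; or any other
  bounded rule): there is `δ ∈ (0, 1]` with `|μ₀Kᵗ(A) − μ_{Λ,β}(A)| ≤ (1 − δ)ᵗ` for EVERY initial law
  `μ₀`, every `t`, every set `A` — the configuration chain of single-step leapfrog HMC converges to
  the Wilson measure from every start, geometrically in total variation;
* **`wilsonMeasure_unique_invariant_u1LeapfrogHMC`** — the Wilson measure is the ONLY probability
  law that single-step leapfrog HMC leaves invariant.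

NOT CLAIMED: `nstep ≥ 2`, OMF words, `tau_jitter`, any useful rate, floating point (as in
`U1LeapfrogHMCErgodic.lean`); that the engine's force IS `−½ε ∂(βS_W)` (the theorem holds for every
bounded measurable increment, so this identification is not needed); the 2D angle-variable engine
`u1_2d` stores `θ` and adds `ε p` — the same update read through `θ ↦ e^{iθ}`.
-/

noncomputable section

namespace Summit.Ventures.LatticeQCDFlow.Exactness

open MeasureTheory ProbabilityTheory ProbabilityTheory.Kernel Set
open Literature.MathematicalPhysics.QuantumFieldTheory
open scoped ENNReal

section Wilson

variable {d L N : ℕ} (ρ : Circle →* Matrix (Fin N) (Fin N) ℂ)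

/-- **The Gibbs law of `S = β S_W` on `U(1)^E` is the Literature's torus Wilson measure** (the two
vocabularies agree definitionally, up to rewriting `−(β S_W)` as `(−β) S_W`). -/
theorem u1GibbsLaw_eq_wilsonMeasure [NeZero L] (β : ℝ) :
    u1GibbsLaw (ι := Edge d L) (fun U : GaugeConfig d L (Circle) =>
        β * wilsonAction ρ U) = wilsonMeasure (d := d) (L := L) ρ β := by
  have h : (fun U : GaugeConfig d L (Circle) =>
        ENNReal.ofReal (Real.exp (-(β * wilsonAction ρ U)))) =
      fun U => ENNReal.ofReal (Real.exp (-β * wilsonAction ρ U)) := by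
    funext U
    rw [neg_mul]
  rw [u1GibbsLaw, h]
  rfl

/-- **The scaled Wilson action is bounded** on the compact configuration space `SU(2)^E` (it is
continuous, `WilsonHeatBathErgodic.continuous_smul_wilsonAction`). -/
theorem exists_bound_smul_wilsonAction_circle [NeZero L] (hρ : Continuous ρ) (β : ℝ) :
    ∃ s : ℝ, ∀ U : GaugeConfig d L (Circle), |β * wilsonAction ρ U| ≤ s := by
  have hc : Continuous fun U : GaugeConfig d L (Circle) =>
      |β * wilsonAction ρ U| := continuous_abs.comp (continuous_smul_wilsonAction ρ hρ β)
  obtain ⟨U₀, -, hmax⟩ := isCompact_univ.exists_isMaxOn univ_nonempty hc.continuousOn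
  exact ⟨|β * wilsonAction ρ U₀|, fun U => (isMaxOn_iff.1 hmax) U (mem_univ U)⟩

/-- **SINGLE-STEP LEAPFROG HMC CONVERGES TO THE WILSON MEASURE FROM EVERY START.**  Torus
`(ℤ/L)^d`, `G = U(1)` with a continuous representation `ρ`, any real `β`; the engine's HMC
configuration kernel with one P-first leapfrog step of size `ε > 0`, Gaussian momenta with kinetic
coefficient `κ > 0`, ANY measurable momentum increment bounded by `b ≥ 0`, Metropolis test on
`β S_W + T_κ`: there is `δ ∈ (0, 1]` with `|μ₀Kᵗ(A) − μ_{Λ,β}(A)| ≤ (1 − δ)ᵗ` for every initial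
law `μ₀`, every `t`, every set `A`. -/
theorem wilson_u1LeapfrogHMC_uniformlyErgodic [NeZero L] (hρ : Continuous ρ) (β : ℝ) {ε κ : ℝ}
    (hε : 0 < ε) (hκ : 0 < κ)
    {g : GaugeConfig d L (Circle) → Edge d L → ℝ}
    (hg : Measurable g) {b : ℝ} (hb0 : 0 ≤ b) (hb : ∀ U e, ‖g U e‖ ≤ b) :
    ∃ δ : ℝ, 0 < δ ∧ δ ≤ 1 ∧
      ∀ (μ₀ : Measure (GaugeConfig d L (Circle))) [IsProbabilityMeasure μ₀]
        (t : ℕ) (A : Set (GaugeConfig d L (Circle))),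
        |((fun m : Measure (GaugeConfig d L (Circle)) =>
              m.bind (u1LeapfrogHMC ε κ hg fun U => β * wilsonAction ρ U))^[t] μ₀).real A
            - (wilsonMeasure ρ β).real A| ≤ (1 - δ) ^ t := by
  obtain ⟨s, hs⟩ := exists_bound_smul_wilsonAction_circle (d := d) (L := L) ρ hρ β
  rw [← u1GibbsLaw_eq_wilsonMeasure (d := d) (L := L) ρ β]
  exact u1LeapfrogHMC_uniformlyErgodic hε hκ hg hb0 hb (continuous_smul_wilsonAction ρ hρ β).measurable hs

/-- **The Wilson measure is the unique invariant probability law of single-step leapfrog HMC** on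
`U(1)` lattice gauge fields (same hypotheses). -/
theorem wilsonMeasure_unique_invariant_u1LeapfrogHMC [NeZero L] (hρ : Continuous ρ) (β : ℝ)
    {ε κ : ℝ} (hε : 0 < ε) (hκ : 0 < κ)
    {g : GaugeConfig d L (Circle) → Edge d L → ℝ}
    (hg : Measurable g) {b : ℝ} (hb0 : 0 ≤ b) (hb : ∀ U e, ‖g U e‖ ≤ b)
    {π' : Measure (GaugeConfig d L (Circle))} [IsProbabilityMeasure π']
    (hπ' : Invariant (u1LeapfrogHMC ε κ hg fun U => β * wilsonAction ρ U) π') :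
    π' = wilsonMeasure ρ β := by
  obtain ⟨s, hs⟩ := exists_bound_smul_wilsonAction_circle (d := d) (L := L) ρ hρ β
  rw [← u1GibbsLaw_eq_wilsonMeasure (d := d) (L := L) ρ β]
  exact u1LeapfrogHMC_invariant_unique hε hκ hg hb0 hb (continuous_smul_wilsonAction ρ hρ β).measurable hs hπ'

end Wilson

end Summit.Ventures.LatticeQCDFlow.Exactness
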